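import Mathlib
import HarnessLib
import Summits.NavierStokesRegularity.Statement
import Summits.NavierStokesRegularity.NavierStokesRegularity.Theses.ConservativeEngine
import Summits.NavierStokesRegularity.NavierStokesRegularity.Theorems.ConservativeEngineConstantNormalisationTools

/-!
# CONSTANT NORMALISATION for N30's deciding crux X_Eᶜ = `ConservativeEngine.ConservativePowerGaugeEulerLiouville` — Part 2/2

Writer port (decomp-ns-writer-1 g9) of decomp-ns lens 6, generation 24, `ConservativeEngineConstantNormalisation.lean`
(sha256 eecf67d9…e378; CRITIC-LEDGER row 258 CLEARED (KERNEL), «landable --supports 27529 RECOMMENDED»).  Part 1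
(`Theorems/ConservativeEngineConstantNormalisationTools.lean`) proved that the amplitude–time dilation maps the class with gauge
constant `c` into the class with constant `μ c` (`0 < μ ≤ 1`) and that a.e. vanishing pulls back.  This part:

* `fixedConstant_normalisation` — if every member of the conservative power-gauged class with constant `≤ c₀` vanishes a.e.
  (the hypotheses of stmt-27529 VERBATIM with `c := c₀`), then so does every member with ANY constant (0 sorry);
* `conservativePowerGaugeEulerLiouville_iff_fixedConstant` — for every fixed `c₀ > 0`, X_Eᶜ (27529) is EQUIVALENT to its own
  restriction to gauge constant `c₀`;
* `fixedConstant_normalisation_XE`, `powerGaugeEulerLiouville_iff_fixedConstant` — the same for the non-conservative parent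
  X_E = `EulerZoomLiouville.PowerGaugeEulerLiouville` (19832).

WHY IT MATTERS (negative knowledge for the decomposition cell decomp-ns; NOT a split, no summit / crux / stub is proved here):
the class `K_ρᶜ(c)` is star-shaped to `0` along an exact symmetry, so there is NO ε-gap / small-constant / «ε-regular» sub-crux
of X_Eᶜ — every fixed-constant engine is the crux itself; verbatim for X_E.  Rung currency: rung 0.
-/

noncomputable section

set_option linter.dupNamespace false

namespace Summit.NavierStokesRegularity.NavierStokesRegularity.Theorems.ConservativeEngine.ConstantNormalisation

open MeasureTheory Set Function
open Literature.Analysis.FluidPDE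
open scoped ENNReal

/-- **CONSTANT NORMALISATION (0 sorry).**  If every member of the conservative power-gauged class with gauge constant
`c₀` vanishes a.e. on `t < 0` — the hypotheses of N30's crux VERBATIM with the constant frozen at a fixed `c₀ > 0` —
then so does every member with ANY constant `c`: a member with `c > c₀` is dilated by `μ = c₀ / c` into the class with
constant `c₀`, and a.e. vanishing pulls back.  (The crux `ConservativePowerGaugeEulerLiouville` is this conclusion with
the binder `c` moved inside: `fun h ρ hρ u p H c => h c ρ hρ u p H`; see `conservativePowerGaugeEulerLiouville_iff_fixedConstant`.) [folklore] -/
theorem fixedConstant_normalisation {c₀ : NNReal} (hc₀ : 0 < c₀)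
    (hAt : ∀ ρ : ℝ, 0 < ρ → ∀ (u : ℝ → (EuclideanSpace ℝ (Fin 3)) → (EuclideanSpace ℝ (Fin 3))) (p : ℝ → (EuclideanSpace ℝ (Fin 3)) → ℝ) (H : ℝ → (EuclideanSpace ℝ (Fin 3)) → (EuclideanSpace ℝ (Fin 3)) →L[ℝ] (EuclideanSpace ℝ (Fin 3))),
      IsSuitableWeakSolutionOn Slab 0 0 u p → HasWeakSpatialGradientOn Slab u H →
      (∀ a : ℝ, 0 < a →
        ENNReal.ofReal (a ^ (2 * ρ)) * cknA a (0 : ℝ × (EuclideanSpace ℝ (Fin 3))) u +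
        ENNReal.ofReal (a ^ ρ) * cknE a (0 : ℝ × (EuclideanSpace ℝ (Fin 3))) H +
        ENNReal.ofReal (a ^ (2 * ρ)) * cknD a (0 : ℝ × (EuclideanSpace ℝ (Fin 3))) p ≤ (c₀ : ENNReal)) →
      (∀ φ : ℝ → (EuclideanSpace ℝ (Fin 3)) → ℝ, IsSpaceTimeTestOn Slab φ →
        ∫ t, ∫ x, (‖u t x‖ ^ 2 * timeDeriv φ t x +
          (‖u t x‖ ^ 2 + 2 * p t x) * inner ℝ (u t x) (gradient (φ t) x)) = 0) →
      Function.uncurry u =ᵐ[volume.restrict (Set.Iio (0 : ℝ) ×ˢ (Set.univ : Set (EuclideanSpace ℝ (Fin 3))))] 0)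
    (c : NNReal) :
    ∀ ρ : ℝ, 0 < ρ → ∀ (u : ℝ → (EuclideanSpace ℝ (Fin 3)) → (EuclideanSpace ℝ (Fin 3))) (p : ℝ → (EuclideanSpace ℝ (Fin 3)) → ℝ) (H : ℝ → (EuclideanSpace ℝ (Fin 3)) → (EuclideanSpace ℝ (Fin 3)) →L[ℝ] (EuclideanSpace ℝ (Fin 3))),
      IsSuitableWeakSolutionOn Slab 0 0 u p → HasWeakSpatialGradientOn Slab u H →
      (∀ a : ℝ, 0 < a →
        ENNReal.ofReal (a ^ (2 * ρ)) * cknA a (0 : ℝ × (EuclideanSpace ℝ (Fin 3))) u +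
        ENNReal.ofReal (a ^ ρ) * cknE a (0 : ℝ × (EuclideanSpace ℝ (Fin 3))) H +
        ENNReal.ofReal (a ^ (2 * ρ)) * cknD a (0 : ℝ × (EuclideanSpace ℝ (Fin 3))) p ≤ (c : ENNReal)) →
      (∀ φ : ℝ → (EuclideanSpace ℝ (Fin 3)) → ℝ, IsSpaceTimeTestOn Slab φ →
        ∫ t, ∫ x, (‖u t x‖ ^ 2 * timeDeriv φ t x +
          (‖u t x‖ ^ 2 + 2 * p t x) * inner ℝ (u t x) (gradient (φ t) x)) = 0) →
      Function.uncurry u =ᵐ[volume.restrict (Set.Iio (0 : ℝ) ×ˢ (Set.univ : Set (EuclideanSpace ℝ (Fin 3))))] 0 := by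
  intro ρ hρ u p H hsw hH hg hle
  by_cases hle' : c ≤ c₀
  · refine hAt ρ hρ u p H hsw hH (fun a ha => (hg a ha).trans ?_) hle
    exact_mod_cast hle'
  · have hlt : c₀ < c := lt_of_not_ge hle'
    have hcpos : (0 : ℝ) < (c : ℝ) := by
      have : (0 : NNReal) < c := lt_trans hc₀ hlt
      exact_mod_cast this
    set μ : ℝ := (c₀ : ℝ) / (c : ℝ) with hμ
    have hμpos : 0 < μ := div_pos (by exact_mod_cast hc₀) hcpos
    have hμle : μ ≤ 1 := by
      rw [hμ, div_le_one hcpos]; exact_mod_cast hlt.le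
    have hconst : Real.toNNReal μ * c = c₀ := by
      apply NNReal.coe_injective
      rw [NNReal.coe_mul, Real.coe_toNNReal _ hμpos.le, hμ]
      field_simp
    have hg' := gauge_dil_le_const hμpos hμle hg
    rw [hconst] at hg'
    exact aeZero_of_aeZero_dil hμpos u
      (hAt ρ hρ (dilU μ u) (dilP μ p) (dilH μ H) (isSuitableWeakSolutionOn_dil hμpos hsw)
        (hasWeakSpatialGradientOn_dil hμpos hH) hg' (localEnergyEq_dil hμpos u p hle))

/-- **No ε-gap sub-crux.**  For every fixed `c₀ > 0`, N30's crux is EQUIVALENT to its own restriction to gauge constant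
`c₀` (`→`: restriction, logic; `←`: `fixedConstant_normalisation`). [folklore] -/
theorem conservativePowerGaugeEulerLiouville_iff_fixedConstant {c₀ : NNReal} (hc₀ : 0 < c₀) :
    Theses.ConservativeEngine.ConservativePowerGaugeEulerLiouville ↔
    ∀ ρ : ℝ, 0 < ρ → ∀ (u : ℝ → (EuclideanSpace ℝ (Fin 3)) → (EuclideanSpace ℝ (Fin 3))) (p : ℝ → (EuclideanSpace ℝ (Fin 3)) → ℝ) (H : ℝ → (EuclideanSpace ℝ (Fin 3)) → (EuclideanSpace ℝ (Fin 3)) →L[ℝ] (EuclideanSpace ℝ (Fin 3))),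
      IsSuitableWeakSolutionOn Slab 0 0 u p → HasWeakSpatialGradientOn Slab u H →
      (∀ a : ℝ, 0 < a →
        ENNReal.ofReal (a ^ (2 * ρ)) * cknA a (0 : ℝ × (EuclideanSpace ℝ (Fin 3))) u +
        ENNReal.ofReal (a ^ ρ) * cknE a (0 : ℝ × (EuclideanSpace ℝ (Fin 3))) H +
        ENNReal.ofReal (a ^ (2 * ρ)) * cknD a (0 : ℝ × (EuclideanSpace ℝ (Fin 3))) p ≤ (c₀ : ENNReal)) →
      (∀ φ : ℝ → (EuclideanSpace ℝ (Fin 3)) → ℝ, IsSpaceTimeTestOn Slab φ →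
        ∫ t, ∫ x, (‖u t x‖ ^ 2 * timeDeriv φ t x +
          (‖u t x‖ ^ 2 + 2 * p t x) * inner ℝ (u t x) (gradient (φ t) x)) = 0) →
      Function.uncurry u =ᵐ[volume.restrict (Set.Iio (0 : ℝ) ×ˢ (Set.univ : Set (EuclideanSpace ℝ (Fin 3))))] 0 :=
  ⟨fun h ρ hρ u p H => h ρ hρ u p H c₀,
   fun h ρ hρ u p H c => fixedConstant_normalisation hc₀ h c ρ hρ u p H⟩

/-- **The same for the non-conservative parent X_E** (`EulerZoomLiouville.PowerGaugeEulerLiouville`, stmt-19832: the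
local energy INEQUALITY with `ν = 0` is dilation-covariant as part of `IsSuitableWeakSolutionOn.stRescale`). [folklore] -/
theorem fixedConstant_normalisation_XE {c₀ : NNReal} (hc₀ : 0 < c₀)
    (hAt : ∀ ρ : ℝ, 0 < ρ → ∀ (u : ℝ → (EuclideanSpace ℝ (Fin 3)) → (EuclideanSpace ℝ (Fin 3))) (p : ℝ → (EuclideanSpace ℝ (Fin 3)) → ℝ) (H : ℝ → (EuclideanSpace ℝ (Fin 3)) → (EuclideanSpace ℝ (Fin 3)) →L[ℝ] (EuclideanSpace ℝ (Fin 3))),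
      IsSuitableWeakSolutionOn Slab 0 0 u p → HasWeakSpatialGradientOn Slab u H →
      (∀ a : ℝ, 0 < a →
        ENNReal.ofReal (a ^ (2 * ρ)) * cknA a (0 : ℝ × (EuclideanSpace ℝ (Fin 3))) u +
        ENNReal.ofReal (a ^ ρ) * cknE a (0 : ℝ × (EuclideanSpace ℝ (Fin 3))) H +
        ENNReal.ofReal (a ^ (2 * ρ)) * cknD a (0 : ℝ × (EuclideanSpace ℝ (Fin 3))) p ≤ (c₀ : ENNReal)) →
      Function.uncurry u =ᵐ[volume.restrict (Set.Iio (0 : ℝ) ×ˢ (Set.univ : Set (EuclideanSpace ℝ (Fin 3))))] 0)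
    (c : NNReal) :
    ∀ ρ : ℝ, 0 < ρ → ∀ (u : ℝ → (EuclideanSpace ℝ (Fin 3)) → (EuclideanSpace ℝ (Fin 3))) (p : ℝ → (EuclideanSpace ℝ (Fin 3)) → ℝ) (H : ℝ → (EuclideanSpace ℝ (Fin 3)) → (EuclideanSpace ℝ (Fin 3)) →L[ℝ] (EuclideanSpace ℝ (Fin 3))),
      IsSuitableWeakSolutionOn Slab 0 0 u p → HasWeakSpatialGradientOn Slab u H →
      (∀ a : ℝ, 0 < a →
        ENNReal.ofReal (a ^ (2 * ρ)) * cknA a (0 : ℝ × (EuclideanSpace ℝ (Fin 3))) u +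
        ENNReal.ofReal (a ^ ρ) * cknE a (0 : ℝ × (EuclideanSpace ℝ (Fin 3))) H +
        ENNReal.ofReal (a ^ (2 * ρ)) * cknD a (0 : ℝ × (EuclideanSpace ℝ (Fin 3))) p ≤ (c : ENNReal)) →
      Function.uncurry u =ᵐ[volume.restrict (Set.Iio (0 : ℝ) ×ˢ (Set.univ : Set (EuclideanSpace ℝ (Fin 3))))] 0 := by
  intro ρ hρ u p H hsw hH hg
  by_cases hle' : c ≤ c₀
  · refine hAt ρ hρ u p H hsw hH (fun a ha => (hg a ha).trans ?_)
    exact_mod_cast hle'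
  · have hlt : c₀ < c := lt_of_not_ge hle'
    have hcpos : (0 : ℝ) < (c : ℝ) := by
      have : (0 : NNReal) < c := lt_trans hc₀ hlt
      exact_mod_cast this
    set μ : ℝ := (c₀ : ℝ) / (c : ℝ) with hμ
    have hμpos : 0 < μ := div_pos (by exact_mod_cast hc₀) hcpos
    have hμle : μ ≤ 1 := by
      rw [hμ, div_le_one hcpos]; exact_mod_cast hlt.le
    have hconst : Real.toNNReal μ * c = c₀ := by
      apply NNReal.coe_injective
      rw [NNReal.coe_mul, Real.coe_toNNReal _ hμpos.le, hμ]
      field_simp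
    have hg' := gauge_dil_le_const hμpos hμle hg
    rw [hconst] at hg'
    exact aeZero_of_aeZero_dil hμpos u
      (hAt ρ hρ (dilU μ u) (dilP μ p) (dilH μ H) (isSuitableWeakSolutionOn_dil hμpos hsw)
        (hasWeakSpatialGradientOn_dil hμpos hH) hg')

/-- **No ε-gap sub-crux of X_E either**: for every `c₀ > 0`, `PowerGaugeEulerLiouville` is equivalent to its
restriction to gauge constant `c₀`. [folklore] -/
theorem powerGaugeEulerLiouville_iff_fixedConstant {c₀ : NNReal} (hc₀ : 0 < c₀) :
    Theses.EulerZoomLiouville.PowerGaugeEulerLiouville ↔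
    ∀ ρ : ℝ, 0 < ρ → ∀ (u : ℝ → (EuclideanSpace ℝ (Fin 3)) → (EuclideanSpace ℝ (Fin 3))) (p : ℝ → (EuclideanSpace ℝ (Fin 3)) → ℝ) (H : ℝ → (EuclideanSpace ℝ (Fin 3)) → (EuclideanSpace ℝ (Fin 3)) →L[ℝ] (EuclideanSpace ℝ (Fin 3))),
      IsSuitableWeakSolutionOn Slab 0 0 u p → HasWeakSpatialGradientOn Slab u H →
      (∀ a : ℝ, 0 < a →
        ENNReal.ofReal (a ^ (2 * ρ)) * cknA a (0 : ℝ × (EuclideanSpace ℝ (Fin 3))) u +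
        ENNReal.ofReal (a ^ ρ) * cknE a (0 : ℝ × (EuclideanSpace ℝ (Fin 3))) H +
        ENNReal.ofReal (a ^ (2 * ρ)) * cknD a (0 : ℝ × (EuclideanSpace ℝ (Fin 3))) p ≤ (c₀ : ENNReal)) →
      Function.uncurry u =ᵐ[volume.restrict (Set.Iio (0 : ℝ) ×ˢ (Set.univ : Set (EuclideanSpace ℝ (Fin 3))))] 0 :=
  ⟨fun h ρ hρ u p H => h ρ hρ u p H c₀,
   fun h ρ hρ u p H c => fixedConstant_normalisation_XE hc₀ h c ρ hρ u p H⟩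

end Summit.NavierStokesRegularity.NavierStokesRegularity.Theorems.ConservativeEngine.ConstantNormalisation

end
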